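import Summits.CriticalPhenomena.PercolationContinuityZ3.Theorems.PercNearOneGluingNoHeavyConstsMDLXJointXEdgeInduction
import HarnessLib

/-!
# CROSS: the "touching-world" form of the two members `M₁`, `M₂` (exact identities; PAPER-2 track (ii), seat `prim-consts-2`, gen 20)

builds on p205010 (kernel theorem, internal audit signed; external expert review pending).  Support file (`--supports
stmt-CriticalPhenomena-4575`); theorems only (two `ring` identities instantiated on the masses of `Consts.polMargin`), no sorries, standard axioms.
Memo `run/shared/lean/prim/consts/FROM-prim-consts-2-g20-AVOID-SPLIT.md` §0(5d).

For nested avoided sets `X ⊂ X' = X ∪ {u}` write `P_{abc} = polMargin μ s y z F X_a X_b X_c` (`X_0 = X`, `X_1 = X'`), `M₀ = P₀₀₀` (the MDL(X)′ margin at `X`),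
`M₃ = P₁₁₁` (at `X'`), `M₁ = P₁₀₀+P₀₁₀+P₀₀₁`, `M₂ = P₁₁₀+P₁₀₁+P₀₁₁` (`Consts.CrossRel` asks `M₁, M₂ ≥ 0`); masses `d = μ(D)`, `d' = μ(D')` (`D = {s↮X}`,
`D' = {s↮X'}`), `t, tw` / `t', tw'` the copy-0 masses for `X` / `X'`, `f, fz, fy, dz, dy` (resp. primed) the integrals/masses over `D` (resp. `D'`).  With the marker
functions `φ_X = t·1_Z − tw·1_Y`, `φ_{X'} = t'·1_Z − tw'·1_Y` and `R = ∫_D φ_X = t·dz − tw·dy`, `R' = ∫_{D'} φ_{X'}`: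
* `Consts.polMargin_M1_touching` — **`d·M₁ = (d + d')·M₀ + d·P₁₀₀ − Θ₁`**, `Θ₁ = d²[t(fz−fz') − tw(fy−fy')] − d·f·[t(dz−dz') − tw(dy−dy')] − d·R·(f−f') + f·R·(d−d')`;
  when `D' ⊆ D` (always), `Θ₁ = d²·∫_{D∖D'} (F − E_νF)(φ_X − E_νφ_X) dμ` is the TOUCHING-WORLD second moment (`D∖D' = D ∩ {s↔u}`, `ν = μ(·|D)`) and
  `P₁₀₀ = d²·Cov_ν(F, φ_{X'})` the crossed bracket, so `M₁/d = (d+d')·Cov_ν(F,φ_X) + d·Cov_ν(F,φ_{X'}) − ∫_{D∩{s↔u}}(F−E_νF)(φ_X−E_νφ_X)`;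
* `Consts.polMargin_M2_touching` — **`d'·M₂ = (d + d')·M₃ + d'·P₀₁₁ + Θ₂`**, `Θ₂ = d'²[t'(fz−fz') − tw'(fy−fy')] − d'f'[t'(dz−dz') − tw'(dy−dy')] − d'R'(f−f') + f'R'(d−d')`
  (`= d'²·∫_{D∩{s↔u}}(F − E_{ν'}F)(φ_{X'} − E_{ν'}φ_{X'}) dμ`, `ν' = μ(·|D')`; `P₀₁₁ = d'²·Cov_{ν'}(F, φ_X)`) — stated here as the ring identity
  `Consts.polMargin_M2_touching_algebra` (instantiate after `unfold polMargin`, exactly as `polMargin_M1_touching` does for `M₁`).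
So each CROSS member = (own MDL(X)′ bracket) + (crossed bracket: own measure, the other avoided set's marker function) ∓ (a touching-world second moment).
Numerics (this seat gen 20, exact, all up-sets): the IH-free residuals `M₁ − (d'/d)·… `, precisely `A1 = M₁ − dd'B₀`, `A2 = M₂ − dd'B₃` of the memo, are ≥ 0 in
229 442 random corner-weight instances n ≤ 7 and 29 596 corner climbs (kit j203754, j203759), 0 violations; `M₁, M₂` 0 violations in ≈ 1.3 M instances.
[cite: VandenbergHaggstromKahn2005, §2.1 (pp. 9–13)]
-/

noncomputable section

namespace Summit.CriticalPhenomena.PercolationContinuityZ3.Theorems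

open MeasureTheory Set Literature.Probability.LatticeModels Literature.Probability.Percolation
open scoped Classical

namespace Consts

variable {V : Type*} [Fintype V]

omit [Fintype V] in
/-- The `M₁` touching-world algebra (ring identity in sixteen masses). [folklore] -/
theorem polMargin_M1_touching_algebra (t tw t' tw' d d' f f' fz fz' dz dz' fy fy' dy dy' : ℝ) :
    d * ((t' * (d * fz - f * dz) - tw' * (d * fy - f * dy)) + (t * (d' * fz - f' * dz) - tw * (d' * fy - f' * dy)) +
        (t * (d * fz' - f * dz') - tw * (d * fy' - f * dy'))) =
      (d + d') * (t * (d * fz - f * dz) - tw * (d * fy - f * dy)) + d * (t' * (d * fz - f * dz) - tw' * (d * fy - f * dy)) -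
        (d ^ 2 * (t * (fz - fz') - tw * (fy - fy')) - d * f * (t * (dz - dz') - tw * (dy - dy')) -
          d * (t * dz - tw * dy) * (f - f') + f * (t * dz - tw * dy) * (d - d')) := by
  ring

omit [Fintype V] in
/-- The `M₂` touching-world algebra (ring identity in sixteen masses). [folklore] -/
theorem polMargin_M2_touching_algebra (t tw t' tw' d d' f f' fz fz' dz dz' fy fy' dy dy' : ℝ) :
    d' * ((t' * (d' * fz - f' * dz) - tw' * (d' * fy - f' * dy)) + (t' * (d * fz' - f * dz') - tw' * (d * fy' - f * dy')) +
        (t * (d' * fz' - f' * dz') - tw * (d' * fy' - f' * dy'))) =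
      (d + d') * (t' * (d' * fz' - f' * dz') - tw' * (d' * fy' - f' * dy')) + d' * (t * (d' * fz' - f' * dz') - tw * (d' * fy' - f' * dy')) +
        (d' ^ 2 * (t' * (fz - fz') - tw' * (fy - fy')) - d' * f' * (t' * (dz - dz') - tw' * (dy - dy')) -
          d' * (t' * dz' - tw' * dy') * (f - f') + f' * (t' * dz' - tw' * dy') * (d - d')) := by
  ring

omit [Fintype V] in
/-- **The touching-world form of the first CROSS member**: for all weights, `s, y, z, u, X`, every `F`, with `X' = X ∪ {u}`,
`μ(D)·[P(X',X,X) + P(X,X',X) + P(X,X,X')] = (μ(D) + μ(D'))·P(X,X,X) + μ(D)·P(X',X,X) − Θ₁` with `Θ₁` as in the module docstring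
(`= μ(D)²·∫_{D∖D'}(F − E_νF)(φ_X − E_νφ_X) dμ`). [cite: VandenbergHaggstromKahn2005, §2.1 (pp. 9–13)] -/
theorem polMargin_M1_touching (w : Sym2 V → unitInterval) (s y z u : V) (X : Set V) (F : Set (Sym2 V) → ℝ) :
    (prodBernoulli w).real {ω : BondConfig V | ∀ x ∈ X, ¬ (openGraph ω).Reachable s x} *
        (polMargin (prodBernoulli w) s y z F (insert u X) X X + polMargin (prodBernoulli w) s y z F X (insert u X) X +
          polMargin (prodBernoulli w) s y z F X X (insert u X)) =
      ((prodBernoulli w).real {ω : BondConfig V | ∀ x ∈ X, ¬ (openGraph ω).Reachable s x} +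
            (prodBernoulli w).real {ω : BondConfig V | ∀ x ∈ insert u X, ¬ (openGraph ω).Reachable s x}) *
          polMargin (prodBernoulli w) s y z F X X X +
        (prodBernoulli w).real {ω : BondConfig V | ∀ x ∈ X, ¬ (openGraph ω).Reachable s x} * polMargin (prodBernoulli w) s y z F (insert u X) X X -
        ((prodBernoulli w).real {ω : BondConfig V | ∀ x ∈ X, ¬ (openGraph ω).Reachable s x} ^ 2 *
            ((prodBernoulli w).real ({ω : BondConfig V | ∀ x ∈ insert s X, ¬ (openGraph ω).Reachable y x} ∩
                {ω | ∀ x ∈ X, ¬ (openGraph ω).Reachable s x}) *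
              ((∫ ω in {ω : BondConfig V | ∀ x ∈ X, ¬ (openGraph ω).Reachable s x} ∩ openConn s z, F (openEdgeCluster ω s) ∂(prodBernoulli w)) -
                ∫ ω in {ω : BondConfig V | ∀ x ∈ insert u X, ¬ (openGraph ω).Reachable s x} ∩ openConn s z, F (openEdgeCluster ω s) ∂(prodBernoulli w)) -
              (prodBernoulli w).real ({ω : BondConfig V | ∀ x ∈ insert s X, ¬ (openGraph ω).Reachable y x} ∩
                {ω | ∀ x ∈ X, ¬ (openGraph ω).Reachable s x} ∩ openConn y z) *
              ((∫ ω in {ω : BondConfig V | ∀ x ∈ X, ¬ (openGraph ω).Reachable s x} ∩ openConn s y, F (openEdgeCluster ω s) ∂(prodBernoulli w)) -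
                ∫ ω in {ω : BondConfig V | ∀ x ∈ insert u X, ¬ (openGraph ω).Reachable s x} ∩ openConn s y, F (openEdgeCluster ω s) ∂(prodBernoulli w))) -
          (prodBernoulli w).real {ω : BondConfig V | ∀ x ∈ X, ¬ (openGraph ω).Reachable s x} *
            (∫ ω in {ω : BondConfig V | ∀ x ∈ X, ¬ (openGraph ω).Reachable s x}, F (openEdgeCluster ω s) ∂(prodBernoulli w)) *
            ((prodBernoulli w).real ({ω : BondConfig V | ∀ x ∈ insert s X, ¬ (openGraph ω).Reachable y x} ∩
                {ω | ∀ x ∈ X, ¬ (openGraph ω).Reachable s x}) *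
              ((prodBernoulli w).real ({ω : BondConfig V | ∀ x ∈ X, ¬ (openGraph ω).Reachable s x} ∩ openConn s z) -
                (prodBernoulli w).real ({ω : BondConfig V | ∀ x ∈ insert u X, ¬ (openGraph ω).Reachable s x} ∩ openConn s z)) -
              (prodBernoulli w).real ({ω : BondConfig V | ∀ x ∈ insert s X, ¬ (openGraph ω).Reachable y x} ∩
                {ω | ∀ x ∈ X, ¬ (openGraph ω).Reachable s x} ∩ openConn y z) *
              ((prodBernoulli w).real ({ω : BondConfig V | ∀ x ∈ X, ¬ (openGraph ω).Reachable s x} ∩ openConn s y) -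
                (prodBernoulli w).real ({ω : BondConfig V | ∀ x ∈ insert u X, ¬ (openGraph ω).Reachable s x} ∩ openConn s y))) -
          (prodBernoulli w).real {ω : BondConfig V | ∀ x ∈ X, ¬ (openGraph ω).Reachable s x} *
            ((prodBernoulli w).real ({ω : BondConfig V | ∀ x ∈ insert s X, ¬ (openGraph ω).Reachable y x} ∩
                {ω | ∀ x ∈ X, ¬ (openGraph ω).Reachable s x}) *
                (prodBernoulli w).real ({ω : BondConfig V | ∀ x ∈ X, ¬ (openGraph ω).Reachable s x} ∩ openConn s z) -
              (prodBernoulli w).real ({ω : BondConfig V | ∀ x ∈ insert s X, ¬ (openGraph ω).Reachable y x} ∩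
                {ω | ∀ x ∈ X, ¬ (openGraph ω).Reachable s x} ∩ openConn y z) *
                (prodBernoulli w).real ({ω : BondConfig V | ∀ x ∈ X, ¬ (openGraph ω).Reachable s x} ∩ openConn s y)) *
            ((∫ ω in {ω : BondConfig V | ∀ x ∈ X, ¬ (openGraph ω).Reachable s x}, F (openEdgeCluster ω s) ∂(prodBernoulli w)) -
              ∫ ω in {ω : BondConfig V | ∀ x ∈ insert u X, ¬ (openGraph ω).Reachable s x}, F (openEdgeCluster ω s) ∂(prodBernoulli w)) +
          (∫ ω in {ω : BondConfig V | ∀ x ∈ X, ¬ (openGraph ω).Reachable s x}, F (openEdgeCluster ω s) ∂(prodBernoulli w)) *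
            ((prodBernoulli w).real ({ω : BondConfig V | ∀ x ∈ insert s X, ¬ (openGraph ω).Reachable y x} ∩
                {ω | ∀ x ∈ X, ¬ (openGraph ω).Reachable s x}) *
                (prodBernoulli w).real ({ω : BondConfig V | ∀ x ∈ X, ¬ (openGraph ω).Reachable s x} ∩ openConn s z) -
              (prodBernoulli w).real ({ω : BondConfig V | ∀ x ∈ insert s X, ¬ (openGraph ω).Reachable y x} ∩
                {ω | ∀ x ∈ X, ¬ (openGraph ω).Reachable s x} ∩ openConn y z) *
                (prodBernoulli w).real ({ω : BondConfig V | ∀ x ∈ X, ¬ (openGraph ω).Reachable s x} ∩ openConn s y)) *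
            ((prodBernoulli w).real {ω : BondConfig V | ∀ x ∈ X, ¬ (openGraph ω).Reachable s x} -
              (prodBernoulli w).real {ω : BondConfig V | ∀ x ∈ insert u X, ¬ (openGraph ω).Reachable s x})) := by
  unfold polMargin
  exact polMargin_M1_touching_algebra _ _ _ _ _ _ _ _ _ _ _ _ _ _ _ _

end Consts

end Summit.CriticalPhenomena.PercolationContinuityZ3.Theorems

end
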